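import Literature.Analysis.FluidPDE.NSAnalyticityRadiusLinftyProofs
import Literature.Analysis.FluidPDE.SecondDifferenceIntegralTubeHolomorphy
import Literature.Analysis.FluidPDE.SelfSimilar
import Literature.Analysis.FluidPDE.VectorCalculus
import HarnessLib

/-!
# Tube analyticity of Type-I ancient mild solutions

Topic `Analysis/FluidPDE`. Theorems only: no definitions, no named facts, no `sorry`.

Guberović 2010 (the `p = ∞` case of Grujić–Kukavica 1998; Bradshaw–Grujić–Kukavica 2016, Thm. 2.4.1),
in the tree as `guberovic2010_analyticity_radius_holds` + `.of_oseen_solution`, APPLIED to the class of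
**Type-I (in time) ancient mild solutions** on `(−∞,0) × ℝ³` (unit viscosity): `‖v(t,x)‖ ≤ C/√(−t)`,
`v` continuous on the slab, `v(t) = e^{(t−s)Δ}v(s) − B¹_s(v,v)(t)` pointwise for all `s < t < 0`,
`v(t)` divergence free and `C¹` for every `t < 0`:

* `exists_tube_extension_of_typeI_ancient_mild` — every slice `v(s)`, `s < 0`, is the restriction of a
  map holomorphic and bounded on a complex tube `complexTube (Fin 3) r`, `r > 0` (radius `∝ √(−s)`):
  restart Guberović's theorem from the datum `v(s')`, `s' = s − τ`, `τ = (−s)/(2c₀²C̄²)`,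
  `C̄ = max C 1`, `‖v(s')‖_∞ ≤ C̄/√(−s) = M`, window `(s', s + τ/2) ⊂ (s', s' + 1/(c₀²M²))`.

Combined with `SecondDifferenceIntegralTubeHolomorphy.lean`
(`analyticOnNhd_fracLaplacianHalf_secondDiff_of_tube`) this makes the second-difference half-Laplacian
`Λ v(s) = ½ ∫ π⁻²‖y‖⁻⁴ (2 v(s,x) − v(s,x+y) − v(s,x−y)) dy` of every slice real-analytic on `ℝ³`:

* `analyticOnNhd_secondDiffIntegral_of_typeI_ancient_mild` — `x ↦ c • ∫ K y • (2 v(s,x) − v(s,x+y) − v(s,x−y))`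
  is real-analytic on `ℝ³` for every measurable kernel `|K y| ≤ A‖y‖⁻⁴` and real `c`;
* `analyticOnNhd_fracLaplacianHalf_of_typeI_ancient_mild` — the case `K = π⁻²‖y‖⁻⁴`, `c = ½`
  (kernel written exactly as `(1 / π ^ 2) * (‖y‖ ^ 4)⁻¹`, matching second-difference definitions of
  `Λ` by `rfl`).

This is the «spread» input of the Navier–Stokes door lines S20 `stub_chiralSpread` / S21-C
`stub_fluxSpread` (nsreg-lit LIT-PACK §R89 (B)+(C)); the profile class there is exactly the above (its
`C¹` slices come from the class' derivative decay).
-/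

noncomputable section

open MeasureTheory Set Function Filter Metric TopologicalSpace
open _root_.Topology
open scoped ENNReal NNReal
open Literature.Analysis.FunctionSpaces.EuclideanSpace (complexify complexify_apply norm_complexify
  complexify_injective continuous_complexify)

namespace Literature.Analysis.FluidPDE

/-- **Slices of Type-I ancient mild solutions are tube-holomorphic** (Guberović 2010 / BGK 2016
Thm. 2.4.1 restarted from `s' = s − τ`): if `‖v(t,x)‖ ≤ C/√(−t)` for `t < 0`, `v` is continuous on
`(−∞,0) × ℝ³`, `v(t) = e^{(t−s)Δ}v(s) − B¹_s(v,v)(t)` pointwise for all `s < t < 0`, and every slice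
`v(t)`, `t < 0`, is divergence free and `C¹`, then for every `s < 0` there are `r > 0`, `B` and
`U : ℂ³ → ℂ³` holomorphic on `complexTube (Fin 3) r` with `U (complexify x) = complexify (v s x)` and
`‖U‖ ≤ B` on the tube.
[cite: BradshawGrujicKukavica2016, Thm. 2.4.1 (PDF p. 31), applied on the window `(s − τ, s + τ/2)`] -/
theorem exists_tube_extension_of_typeI_ancient_mild {C : ℝ}
    {v : ℝ → EuclideanSpace ℝ (Fin 3) → EuclideanSpace ℝ (Fin 3)} (hTI : HasTypeITimeDecay C v)
    (hcont : ContinuousOn (uncurry v) (Iio (0 : ℝ) ×ˢ univ))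
    (hmild : ∀ s t : ℝ, s < t → t < 0 → ∀ x,
      v t x = UnboundedOperators.heatExtension (v s) (t - s) x - oseenDuhamel 1 s v v t x)
    (hdiv : ∀ t < 0, VectorCalculus.IsDivFree (v t)) (hC1 : ∀ t < 0, ContDiff ℝ 1 (v t))
    {s : ℝ} (hs : s < 0) :
    ∃ r : ℝ, 0 < r ∧ ∃ (B : ℝ) (U : EuclideanSpace ℂ (Fin 3) → EuclideanSpace ℂ (Fin 3)),
      DifferentiableOn ℂ U (complexTube (Fin 3) r) ∧ (∀ x, U (complexify x) = complexify (v s x)) ∧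
      ∀ z ∈ complexTube (Fin 3) r, ‖U z‖ ≤ B := by
  obtain ⟨c₀, hc₀, hG⟩ := guberovic2010_analyticity_radius_holds.of_oseen_solution
  have hc₀0 : 0 < c₀ := one_pos.trans hc₀
  -- slices are continuous
  have hslice : ∀ t < 0, Continuous (v t) := fun t ht =>
    hcont.comp_continuous (Continuous.prodMk_right t) fun x => ⟨ht, mem_univ _⟩
  -- `C ≥ 0`
  have hC0 : 0 ≤ C := by
    have h := hTI (-1) (by norm_num) 0
    rw [neg_neg, Real.sqrt_one, div_one] at h
    exact (norm_nonneg _).trans h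
  -- constants
  set Cb : ℝ := max C 1 with hCb
  have hCb1 : 1 ≤ Cb := le_max_right _ _
  have hCb0 : 0 < Cb := one_pos.trans_le hCb1
  have hCCb : C ≤ Cb := le_max_left _ _
  have hms : 0 < -s := neg_pos.2 hs
  set M : ℝ := Cb / Real.sqrt (-s) with hM
  have hsq : 0 < Real.sqrt (-s) := Real.sqrt_pos.2 hms
  have hM0 : 0 < M := div_pos hCb0 hsq
  set τ : ℝ := (-s) / (2 * c₀ ^ 2 * Cb ^ 2) with hτ
  have hτ0 : 0 < τ := by positivity
  have hc2 : 1 ≤ c₀ ^ 2 * Cb ^ 2 := one_le_mul_of_one_le_of_one_le (one_le_pow₀ hc₀.le) (one_le_pow₀ hCb1)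
  have hτle : τ ≤ (-s) / 2 := by
    rw [hτ, div_le_div_iff₀ (by positivity) two_pos]
    nlinarith
  set s' : ℝ := s - τ with hs'
  set T₁ : ℝ := s + τ / 2 with hT₁
  have hs's : s' < s := by rw [hs']; linarith
  have hT₁0 : T₁ < 0 := by rw [hT₁]; linarith
  have hsT₁ : s < T₁ := by rw [hT₁]; linarith
  have hs'0 : s' < 0 := hs's.trans hs
  -- the window fits: `T₁ - s' = 3τ/2 ≤ 1/(c₀² M²) = (-s)/(c₀² Cb²) = 2τ`
  have hwin : T₁ ≤ s' + 1 / (c₀ ^ 2 * M ^ 2) := by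
    have e : 1 / (c₀ ^ 2 * M ^ 2) = 2 * τ := by
      rw [hM, hτ, div_pow, Real.sq_sqrt hms.le]
      field_simp
    rw [e, hT₁, hs']
    linarith
  -- the datum `a = v s'`
  have ha_meas : AEStronglyMeasurable (v s') volume := (hslice s' hs'0).aestronglyMeasurable
  have ha_bd : ∀ x, ‖v s' x‖ ≤ M := by
    intro x
    refine (hTI s' hs'0 x).trans ?_
    rw [hM]
    have h1 : Real.sqrt (-s) ≤ Real.sqrt (-s') := Real.sqrt_le_sqrt (by linarith)
    calc C / Real.sqrt (-s') ≤ Cb / Real.sqrt (-s') := div_le_div_of_nonneg_right hCCb (hsq.trans_le h1).le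
      _ ≤ Cb / Real.sqrt (-s) := div_le_div_of_nonneg_left hCb0.le hsq h1
  have ha_Linf : eLpNorm (v s') ∞ volume ≤ ENNReal.ofReal M := by
    rw [eLpNorm_exponent_top]
    exact eLpNormEssSup_le_of_ae_bound (Eventually.of_forall ha_bd)
  have ha_div : IsWeaklyDivFree (v s') :=
    VectorCalculus.IsDivFree.isWeaklyDivFree_holds (hdiv s' hs'0) (hC1 s' hs'0)
  -- `w = v` on the window
  have hw_meas : AEStronglyMeasurable (uncurry v)
      ((volume : Measure (ℝ × EuclideanSpace ℝ (Fin 3))).restrict (Ioo s' T₁ ×ˢ univ)) := by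
    refine (hcont.mono (prod_mono (fun t ht => ?_) Subset.rfl)).aestronglyMeasurable
      (measurableSet_Ioo.prod MeasurableSet.univ)
    exact (ht.2.trans hT₁0 : t < 0)
  have hM' : 0 ≤ C / Real.sqrt (-T₁) := div_nonneg hC0 (Real.sqrt_nonneg _)
  have hw_bd : ∀ t ∈ Ioo s' T₁, eLpNorm (v t) ∞ volume ≤ ENNReal.ofReal (C / Real.sqrt (-T₁)) := by
    intro t ht
    have ht0 : t < 0 := ht.2.trans hT₁0
    rw [eLpNorm_exponent_top]
    refine eLpNormEssSup_le_of_ae_bound (Eventually.of_forall fun x => (hTI t ht0 x).trans ?_)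
    have hT : 0 < Real.sqrt (-T₁) := Real.sqrt_pos.2 (neg_pos.2 hT₁0)
    exact div_le_div_of_nonneg_left hC0 hT (Real.sqrt_le_sqrt (by linarith [ht.2]))
  have hw_eq : ∀ t ∈ Ioo s' T₁, v t =ᵐ[volume] fun x =>
      UnboundedOperators.heatExtension (v s') (1 * (t - s')) x - oseenDuhamel 1 s' v v t x := by
    intro t ht
    rw [one_mul]
    exact Eventually.of_forall fun x => hmild s' t ht.1 (ht.2.trans hT₁0) x
  have hw_cont : ∀ t ∈ Ioo s' T₁, Continuous (v t) := fun t ht => hslice t (ht.2.trans hT₁0)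
  -- Guberović's theorem on the window, evaluated at `t = s`
  obtain ⟨U, hUd, hUv, hUb⟩ := hG one_pos s' hM0 ha_meas ha_Linf ha_div (hs's.trans hsT₁) hwin hM'
    hw_meas hw_bd hw_eq hw_cont s ⟨hs's, hsT₁⟩
  exact ⟨c₀⁻¹ * Real.sqrt (1 * (s - s')), guberovic2010_radius_pos hc₀0 one_pos hs's, c₀ * M, U,
    hUd, hUv, hUb⟩

/-- **`Λ_K v(s)` is real-analytic for Type-I ancient mild solutions**: under the hypotheses of
`exists_tube_extension_of_typeI_ancient_mild`, for every `s < 0`, every measurable kernel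
`|K y| ≤ A‖y‖⁻⁴` (`A ≥ 0`) and every real `c`, the map
`x ↦ c • ∫ K y • (2 v(s,x) − v(s,x+y) − v(s,x−y)) dy` is real-analytic on `ℝ³`
(`analyticOnNhd_secondDiffIntegral_of_tube` on the tube extension of the slice).
[cite: BradshawGrujicKukavica2016, Thm. 2.4.1 (PDF p. 31); HormanderSCV1973, Thm 2.2.7] -/
theorem analyticOnNhd_secondDiffIntegral_of_typeI_ancient_mild {C : ℝ}
    {v : ℝ → EuclideanSpace ℝ (Fin 3) → EuclideanSpace ℝ (Fin 3)} (hTI : HasTypeITimeDecay C v)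
    (hcont : ContinuousOn (uncurry v) (Iio (0 : ℝ) ×ˢ univ))
    (hmild : ∀ s t : ℝ, s < t → t < 0 → ∀ x,
      v t x = UnboundedOperators.heatExtension (v s) (t - s) x - oseenDuhamel 1 s v v t x)
    (hdiv : ∀ t < 0, VectorCalculus.IsDivFree (v t)) (hC1 : ∀ t < 0, ContDiff ℝ 1 (v t))
    {s : ℝ} (hs : s < 0) {A : ℝ} (hA : 0 ≤ A) {K : EuclideanSpace ℝ (Fin 3) → ℝ} (hKm : Measurable K)
    (hK : ∀ y, |K y| ≤ A * (‖y‖ ^ 4)⁻¹) (c : ℝ) :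
    AnalyticOnNhd ℝ (fun x => c • ∫ y, K y • ((2 : ℝ) • v s x - v s (x + y) - v s (x - y))) univ := by
  obtain ⟨r, hr, B, U, hUd, hUv, hUb⟩ :=
    exists_tube_extension_of_typeI_ancient_mild hTI hcont hmild hdiv hC1 hs
  exact analyticOnNhd_secondDiffIntegral_of_tube hr hA hKm hK hUd hUv hUb c

/-- **`Λ v(s) = (−Δ)^{1/2} v(s)` (second-difference form, kernel `π⁻²‖y‖⁻⁴`, factor `½`) is
real-analytic on `ℝ³` for every slice of a Type-I ancient mild solution** — the «Λv analytic» input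
of the Navier–Stokes door lines, with the kernel written exactly as `(1 / π ^ 2) * (‖y‖ ^ 4)⁻¹` so that
second-difference definitions of `Λ` match by `rfl`.
[cite: BradshawGrujicKukavica2016, Thm. 2.4.1 (PDF p. 31); DinezzaPalatucciValdinoci2012, Lemma 3.2 (second-difference form of `(−Δ)^s`)] -/
theorem analyticOnNhd_fracLaplacianHalf_of_typeI_ancient_mild {C : ℝ}
    {v : ℝ → EuclideanSpace ℝ (Fin 3) → EuclideanSpace ℝ (Fin 3)} (hTI : HasTypeITimeDecay C v)
    (hcont : ContinuousOn (uncurry v) (Iio (0 : ℝ) ×ˢ univ))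
    (hmild : ∀ s t : ℝ, s < t → t < 0 → ∀ x,
      v t x = UnboundedOperators.heatExtension (v s) (t - s) x - oseenDuhamel 1 s v v t x)
    (hdiv : ∀ t < 0, VectorCalculus.IsDivFree (v t)) (hC1 : ∀ t < 0, ContDiff ℝ 1 (v t))
    {s : ℝ} (hs : s < 0) :
    AnalyticOnNhd ℝ (fun x => (1 / 2 : ℝ) • ∫ y, ((1 / Real.pi ^ 2) * (‖y‖ ^ 4)⁻¹) •
      ((2 : ℝ) • v s x - v s (x + y) - v s (x - y))) univ := by
  obtain ⟨r, hr, B, U, hUd, hUv, hUb⟩ :=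
    exists_tube_extension_of_typeI_ancient_mild hTI hcont hmild hdiv hC1 hs
  exact analyticOnNhd_fracLaplacianHalf_secondDiff_of_tube hr hUd hUv hUb

end Literature.Analysis.FluidPDE
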